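import Mathlib.Tactic

/-!
# Bounded live region of the generic one-type universe (pub-hsemireg, W2 seat w2-t1-1, gen 22)

Kernel transcription of the BOUNDEDNESS STEP (G2)–(G3) of THEOREM (41-GEN-BOUNDED) of the record
memo `widen/W2/w2t11/GENLIVE-w2t11g22.md` (one-type-per-pencil universe of a generic member class τ
of the with-sections floor model; weights `W = (w_a, w_b) =: (p, q)`; balanced aggregates `S(W)`
K-affine by (41-GEN)).  LINEAGE SIDE (not formalised; symbolic ×1 by `genlive/live41G_symbolic.py` +
`polyq.py`, kit j228020, output sha256/16 `e672619fda1e53b1`; ×2 by method against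
`rowuniv_check.live_exact` and the (41f-2) census): the 12 live equations scaled by `w_a w_b` have a
weight-free matrix of rank 6 whose kernel vanishes on `(n_a, n_b)`, so `ñ_a = w_a w_b n_a`, `ñ_b =
w_a w_b n_b` are the same for every solution at `W` and equal the printed particular-solution
components.
WHAT IS CHECKED HERE, for each of the four class types X ∈ {f, ad, d7, G} (f = f0, f1, f2; ad = ad,
(1:2), (2:1); d7 = (1:−2), (2:−1); G = G, G2 — the ten generic menu classes), as explicit polynomial
statements (no definitions):
* `nTildeA_X`, `nTildeB_X`: the printed cubics factor as `ñ_a = -(q / N(Δ)) · E_X`, `ñ_b = -(p /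
  N(Δ)) · E_X`;
* `E_centred_X`: `E_X = Q(p - a, q - a) - N(Δ)/3` with `Q(x, y) = x² + x y + y²`, so that `w_a n_a =
  w_b n_b = 1/3 - Q(w_a - a, w_b - a)/N(Δ)` (`weightedN_X`); `fourE_X`: `4 E_X = (2q + p - 3a)² + 3
  (p - lo)(p - hi)`;
* `bound_X`: `E_X ≤ 0 → lo ≤ p ≤ hi ∧ lo ≤ q ≤ hi`; `liveBox_X`: `0 < q → 0 ≤ ñ_a → p ≤ hi ∧ q ≤ hi`
  (a feasible point of the live system has `n_a ≥ 0`; hence LIVE ⇒ `W` in the box `[1..1]², [1..4]²,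
  [1..9]², [1..3]²`);
* `intPoints_X`: the positive integer pairs with `E_X ≤ 0` lie in an explicit finite set `S_X` (the
  integer points of the closed ellipse); the LIVE lists of record ((41f-2) = memo (G4)) are subsets
  of `S_X` (`live_sub_X`).
The DEAD/LIVE decision of each point of `S_X` (an exact 1-D problem on the symbolic solution line)
is the memo's, not formalised here.  RECORD ONLY; W2 counts 0 ∕ 0 ∕ 0 unchanged.  Honest framing:
nothing here says HC / HC_CM / HC_AV is proved.
-/

namespace Summit.Ventures.HSemireg.GenericLiveBound

variable {R : Type*} [CommRing R]
variable {K : Type*} [Field K] [CharZero K]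
variable {F : Type*} [Field F] [LinearOrder F] [IsStrictOrderedRing F]

/-! ## Type f: classes f0, f1, f2 (N(Δ) = 1); centre a = 2 / 3, box [0, 4 / 3] -/

/-- (G2) type f: the printed `ñ_a` component of the particular solution equals `-q · E_f`. -/
theorem nTildeA_f (p q : R) :
    -p ^ 2 * q - p * q ^ 2 - q ^ 3 + 2 * p * q + 2 * q ^ 2 - q
      = -q * (p ^ 2 + p * q + q ^ 2 - 2 * p - 2 * q + 1) := by
  ring

/-- (G2) type f: the printed `ñ_b` component equals `-p · E_f`. -/
theorem nTildeB_f (p q : R) :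
    -p ^ 3 - p ^ 2 * q - p * q ^ 2 + 2 * p ^ 2 + 2 * p * q - p
      = -p * (p ^ 2 + p * q + q ^ 2 - 2 * p - 2 * q + 1) := by
  ring

/-- (G2) type f: centred form `E_f = Q(p - a, q - a) - N(Δ)/3` with a = 2 / 3, N(Δ) = 1. -/
theorem E_centred_f (p q : K) :
    p ^ 2 + p * q + q ^ 2 - 2 * p - 2 * q + 1
      = (p - (2 / 3 : K)) ^ 2 + (p - (2 / 3 : K)) * (q - (2 / 3 : K)) + (q - (2 / 3 : K)) ^ 2
          - (1 / 3 : K) := by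
  ring

/-- (G2) type f, unscaled: if `p q n_a = ñ_a` and `p q n_b = ñ_b` with `p, q ≠ 0` then
`p · n_a = q · n_b = 1/3 - Q(p - a, q - a) / N(Δ)` (the weighted n-law `w_a n_a = w_b n_b`). -/
theorem weightedN_f (p q na nb : K) (hp : p ≠ 0) (hq : q ≠ 0)
    (ha : p * q * na = -p ^ 2 * q - p * q ^ 2 - q ^ 3 + 2 * p * q + 2 * q ^ 2 - q)
    (hb : p * q * nb = -p ^ 3 - p ^ 2 * q - p * q ^ 2 + 2 * p ^ 2 + 2 * p * q - p) :
    p * na = 1 / 3 - ((p - (2 / 3 : K)) ^ 2 + (p - (2 / 3 : K)) * (q - (2 / 3 : K)) + (q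
        - (2 / 3 : K)) ^ 2) ∧
      q * nb = 1 / 3 - ((p - (2 / 3 : K)) ^ 2 + (p - (2 / 3 : K)) * (q - (2 / 3 : K)) + (q
          - (2 / 3 : K)) ^ 2) := by
  refine ⟨mul_left_cancel₀ hq ?_, mul_left_cancel₀ hp ?_⟩
  · rw [← mul_assoc, mul_comm q p, ha]; ring
  · rw [← mul_assoc, hb]; ring

/-- (G3) type f: `4 E_f = (2q + p - 3a)² + 3 (p - lo)(p - hi)` with lo = 0, hi = 4 / 3. -/
theorem fourE_f (p q : K) :
    4 * (p ^ 2 + p * q + q ^ 2 - 2 * p - 2 * q + 1)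
      = (2 * q + p - 2) ^ 2 + 3 * (p * (p - (4 / 3 : K))) := by
  ring

/-- (G3) type f: `E_f ≤ 0` confines both weights to `[lo, hi] = [0, 4 / 3]`. -/
theorem bound_f (p q : F)
    (hE : p ^ 2 + p * q + q ^ 2 - 2 * p - 2 * q + 1 ≤ 0) :
    ((0 : F) ≤ p ∧ p ≤ 4 / 3) ∧ ((0 : F) ≤ q ∧ q ≤ 4 / 3) := by
  refine ⟨⟨?_, ?_⟩, ⟨?_, ?_⟩⟩ <;> nlinarith [fourE_f p q, fourE_f q p,
    sq_nonneg (2 * q + p - 2), sq_nonneg (2 * p + q - 2)]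

/-- (G3) type f: a feasible point of the live system (weight `q > 0`) has `ñ_a ≥ 0`, hence lies in
the box `p, q ≤ 4 / 3` (LIVE ⇒ `W ∈ [1..1]²` for positive integer weights). -/
theorem liveBox_f (p q : F) (hq : 0 < q)
    (hna : 0 ≤ -p ^ 2 * q - p * q ^ 2 - q ^ 3 + 2 * p * q + 2 * q ^ 2 - q) :
    p ≤ 4 / 3 ∧ q ≤ 4 / 3 := by
  rw [nTildeA_f] at hna
  have hE : p ^ 2 + p * q + q ^ 2 - 2 * p - 2 * q + 1 ≤ 0 := by
    rcases lt_or_ge 0 (p ^ 2 + p * q + q ^ 2 - 2 * p - 2 * q + 1) with h | h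
    · have : 0 < q * (p ^ 2 + p * q + q ^ 2 - 2 * p - 2 * q + 1) := mul_pos (by positivity) h
      linarith
    · exact h
  exact ⟨(bound_f p q hE).1.2, (bound_f p q hE).2.2⟩

/-- (G3)–(G4) type f over ℤ: the positive integer weight pairs with `E_f ≤ 0` (the closed ellipse)
form the explicit set `S_f` of 1 pair. -/
theorem intPoints_f (p q : ℤ) (hp : 1 ≤ p) (hq : 1 ≤ q)
    (hE : p ^ 2 + p * q + q ^ 2 - 2 * p - 2 * q + 1 ≤ 0) :
    (p, q) ∈ ({(1, 1)} : Finset (ℤ × ℤ)) := by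
  have hp2 : p ≤ 1 := by nlinarith [sq_nonneg (2 * q + p - 2)]
  have hq2 : q ≤ 1 := by nlinarith [sq_nonneg (2 * p + q - 2)]
  interval_cases p; interval_cases q; decide

/-- type f: the LIVE weight pairs of record (memo (G4) = table (41f-2); 1 pairs) form a subset of
`S_f`. -/
theorem live_sub_f :
    ({(1, 1)} : Finset (ℤ × ℤ))
      ⊆ ({(1, 1)} : Finset (ℤ × ℤ)) := by
  decide

/-! ## Type ad: classes ad, (1:2), (2:1) (N(Δ) = 9); centre a = 2, box [0, 4] -/

/-- (G2) type ad: the printed `ñ_a` component of the particular solution equals `-(q / 9) · E_ad`.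
-/
theorem nTildeA_ad (p q : K) :
    -(1 / 9) * p ^ 2 * q - (1 / 9) * p * q ^ 2 - (1 / 9) * q ^ 3 + (2 / 3) * p * q
        + (2 / 3) * q ^ 2 - q
      = -(q / 9) * (p ^ 2 + p * q + q ^ 2 - 6 * p - 6 * q + 9) := by
  ring

/-- (G2) type ad: the printed `ñ_b` component equals `-(p / 9) · E_ad`. -/
theorem nTildeB_ad (p q : K) :
    -(1 / 9) * p ^ 3 - (1 / 9) * p ^ 2 * q - (1 / 9) * p * q ^ 2 + (2 / 3) * p ^ 2
        + (2 / 3) * p * q - p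
      = -(p / 9) * (p ^ 2 + p * q + q ^ 2 - 6 * p - 6 * q + 9) := by
  ring

/-- (G2) type ad: centred form `E_ad = Q(p - a, q - a) - N(Δ)/3` with a = 2, N(Δ) = 9. -/
theorem E_centred_ad (p q : R) :
    p ^ 2 + p * q + q ^ 2 - 6 * p - 6 * q + 9
      = (p - (2 : R)) ^ 2 + (p - (2 : R)) * (q - (2 : R)) + (q - (2 : R)) ^ 2 - (3 : R) := by
  ring

/-- (G2) type ad, unscaled: if `p q n_a = ñ_a` and `p q n_b = ñ_b` with `p, q ≠ 0` then
`p · n_a = q · n_b = 1/3 - Q(p - a, q - a) / N(Δ)` (the weighted n-law `w_a n_a = w_b n_b`). -/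
theorem weightedN_ad (p q na nb : K) (hp : p ≠ 0) (hq : q ≠ 0)
    (ha : p * q * na = -(1 / 9) * p ^ 2 * q - (1 / 9) * p * q ^ 2 - (1 / 9) * q ^ 3
        + (2 / 3) * p * q + (2 / 3) * q ^ 2 - q)
    (hb : p * q * nb = -(1 / 9) * p ^ 3 - (1 / 9) * p ^ 2 * q - (1 / 9) * p * q ^ 2
        + (2 / 3) * p ^ 2 + (2 / 3) * p * q - p) :
    p * na = 1 / 3 - ((p - (2 : K)) ^ 2 + (p - (2 : K)) * (q - (2 : K)) + (q - (2 : K)) ^ 2) / 9 ∧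
      q * nb = 1 / 3 - ((p - (2 : K)) ^ 2 + (p - (2 : K)) * (q - (2 : K)) + (q
          - (2 : K)) ^ 2) / 9 := by
  refine ⟨mul_left_cancel₀ hq ?_, mul_left_cancel₀ hp ?_⟩
  · rw [← mul_assoc, mul_comm q p, ha]; ring
  · rw [← mul_assoc, hb]; ring

/-- (G3) type ad: `4 E_ad = (2q + p - 3a)² + 3 (p - lo)(p - hi)` with lo = 0, hi = 4. -/
theorem fourE_ad (p q : R) :
    4 * (p ^ 2 + p * q + q ^ 2 - 6 * p - 6 * q + 9)
      = (2 * q + p - 6) ^ 2 + 3 * (p * (p - (4 : R))) := by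
  ring

/-- (G3) type ad: `E_ad ≤ 0` confines both weights to `[lo, hi] = [0, 4]`. -/
theorem bound_ad (p q : F)
    (hE : p ^ 2 + p * q + q ^ 2 - 6 * p - 6 * q + 9 ≤ 0) :
    ((0 : F) ≤ p ∧ p ≤ 4) ∧ ((0 : F) ≤ q ∧ q ≤ 4) := by
  refine ⟨⟨?_, ?_⟩, ⟨?_, ?_⟩⟩ <;> nlinarith [fourE_ad p q, fourE_ad q p,
    sq_nonneg (2 * q + p - 6), sq_nonneg (2 * p + q - 6)]

/-- (G3) type ad: a feasible point of the live system (weight `q > 0`) has `ñ_a ≥ 0`, hence lies in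
the box `p, q ≤ 4` (LIVE ⇒ `W ∈ [1..4]²` for positive integer weights). -/
theorem liveBox_ad (p q : F) (hq : 0 < q)
    (hna : 0 ≤ -(1 / 9) * p ^ 2 * q - (1 / 9) * p * q ^ 2 - (1 / 9) * q ^ 3 + (2 / 3) * p * q
        + (2 / 3) * q ^ 2 - q) :
    p ≤ 4 ∧ q ≤ 4 := by
  rw [nTildeA_ad] at hna
  have hE : p ^ 2 + p * q + q ^ 2 - 6 * p - 6 * q + 9 ≤ 0 := by
    rcases lt_or_ge 0 (p ^ 2 + p * q + q ^ 2 - 6 * p - 6 * q + 9) with h | h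
    · have : 0 < q / 9 * (p ^ 2 + p * q + q ^ 2 - 6 * p - 6 * q + 9) := mul_pos (by positivity) h
      linarith
    · exact h
  exact ⟨(bound_ad p q hE).1.2, (bound_ad p q hE).2.2⟩

/-- (G3)–(G4) type ad over ℤ: the positive integer weight pairs with `E_ad ≤ 0` (the closed ellipse)
form the explicit set `S_ad` of 11 pairs. -/
theorem intPoints_ad (p q : ℤ) (hp : 1 ≤ p) (hq : 1 ≤ q)
    (hE : p ^ 2 + p * q + q ^ 2 - 6 * p - 6 * q + 9 ≤ 0) :
    (p, q) ∈ ({(1, 1), (1, 2), (1, 3), (1, 4), (2, 1), (2, 2), (2, 3), (3, 1), (3, 2), (3, 3),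
        (4, 1)} : Finset (ℤ × ℤ)) := by
  have hp2 : p ≤ 4 := by nlinarith [sq_nonneg (2 * q + p - 6)]
  have hq2 : q ≤ 4 := by nlinarith [sq_nonneg (2 * p + q - 6)]
  interval_cases p <;> interval_cases q <;> first | decide | (exfalso; norm_num at hE)

/-- type ad: the LIVE weight pairs of record (memo (G4) = table (41f-2); 8 pairs) form a subset of
`S_ad`. -/
theorem live_sub_ad :
    ({(1, 2), (1, 3), (2, 1), (2, 2), (2, 3), (3, 1), (3, 2), (3, 3)} : Finset (ℤ × ℤ))
      ⊆ ({(1, 1), (1, 2), (1, 3), (1, 4), (2, 1), (2, 2), (2, 3), (3, 1), (3, 2), (3, 3),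
          (4, 1)} : Finset (ℤ × ℤ)) := by
  decide

/-! ## Type d7: classes (1:-2), (2:-1) (N(Δ) = 49); centre a = 14 / 3, box [0, 28 / 3] -/

/-- (G2) type d7: the printed `ñ_a` component of the particular solution equals `-(q / 49) · E_d7`.
-/
theorem nTildeA_d7 (p q : K) :
    -(1 / 49) * p ^ 2 * q - (1 / 49) * p * q ^ 2 - (1 / 49) * q ^ 3 + (2 / 7) * p * q
        + (2 / 7) * q ^ 2 - q
      = -(q / 49) * (p ^ 2 + p * q + q ^ 2 - 14 * p - 14 * q + 49) := by
  ring

/-- (G2) type d7: the printed `ñ_b` component equals `-(p / 49) · E_d7`. -/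
theorem nTildeB_d7 (p q : K) :
    -(1 / 49) * p ^ 3 - (1 / 49) * p ^ 2 * q - (1 / 49) * p * q ^ 2 + (2 / 7) * p ^ 2
        + (2 / 7) * p * q - p
      = -(p / 49) * (p ^ 2 + p * q + q ^ 2 - 14 * p - 14 * q + 49) := by
  ring

/-- (G2) type d7: centred form `E_d7 = Q(p - a, q - a) - N(Δ)/3` with a = 14 / 3, N(Δ) = 49. -/
theorem E_centred_d7 (p q : K) :
    p ^ 2 + p * q + q ^ 2 - 14 * p - 14 * q + 49
      = (p - (14 / 3 : K)) ^ 2 + (p - (14 / 3 : K)) * (q - (14 / 3 : K)) + (q - (14 / 3 : K)) ^ 2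
          - (49 / 3 : K) := by
  ring

/-- (G2) type d7, unscaled: if `p q n_a = ñ_a` and `p q n_b = ñ_b` with `p, q ≠ 0` then
`p · n_a = q · n_b = 1/3 - Q(p - a, q - a) / N(Δ)` (the weighted n-law `w_a n_a = w_b n_b`). -/
theorem weightedN_d7 (p q na nb : K) (hp : p ≠ 0) (hq : q ≠ 0)
    (ha : p * q * na = -(1 / 49) * p ^ 2 * q - (1 / 49) * p * q ^ 2 - (1 / 49) * q ^ 3
        + (2 / 7) * p * q + (2 / 7) * q ^ 2 - q)
    (hb : p * q * nb = -(1 / 49) * p ^ 3 - (1 / 49) * p ^ 2 * q - (1 / 49) * p * q ^ 2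
        + (2 / 7) * p ^ 2 + (2 / 7) * p * q - p) :
    p * na = 1 / 3 - ((p - (14 / 3 : K)) ^ 2 + (p - (14 / 3 : K)) * (q - (14 / 3 : K)) + (q
        - (14 / 3 : K)) ^ 2) / 49 ∧
      q * nb = 1 / 3 - ((p - (14 / 3 : K)) ^ 2 + (p - (14 / 3 : K)) * (q - (14 / 3 : K)) + (q
          - (14 / 3 : K)) ^ 2) / 49 := by
  refine ⟨mul_left_cancel₀ hq ?_, mul_left_cancel₀ hp ?_⟩
  · rw [← mul_assoc, mul_comm q p, ha]; ring
  · rw [← mul_assoc, hb]; ring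

/-- (G3) type d7: `4 E_d7 = (2q + p - 3a)² + 3 (p - lo)(p - hi)` with lo = 0, hi = 28 / 3. -/
theorem fourE_d7 (p q : K) :
    4 * (p ^ 2 + p * q + q ^ 2 - 14 * p - 14 * q + 49)
      = (2 * q + p - 14) ^ 2 + 3 * (p * (p - (28 / 3 : K))) := by
  ring

/-- (G3) type d7: `E_d7 ≤ 0` confines both weights to `[lo, hi] = [0, 28 / 3]`. -/
theorem bound_d7 (p q : F)
    (hE : p ^ 2 + p * q + q ^ 2 - 14 * p - 14 * q + 49 ≤ 0) :
    ((0 : F) ≤ p ∧ p ≤ 28 / 3) ∧ ((0 : F) ≤ q ∧ q ≤ 28 / 3) := by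
  refine ⟨⟨?_, ?_⟩, ⟨?_, ?_⟩⟩ <;> nlinarith [fourE_d7 p q, fourE_d7 q p,
    sq_nonneg (2 * q + p - 14), sq_nonneg (2 * p + q - 14)]

/-- (G3) type d7: a feasible point of the live system (weight `q > 0`) has `ñ_a ≥ 0`, hence lies in
the box `p, q ≤ 28 / 3` (LIVE ⇒ `W ∈ [1..9]²` for positive integer weights). -/
theorem liveBox_d7 (p q : F) (hq : 0 < q)
    (hna : 0 ≤ -(1 / 49) * p ^ 2 * q - (1 / 49) * p * q ^ 2 - (1 / 49) * q ^ 3 + (2 / 7) * p * q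
        + (2 / 7) * q ^ 2 - q) :
    p ≤ 28 / 3 ∧ q ≤ 28 / 3 := by
  rw [nTildeA_d7] at hna
  have hE : p ^ 2 + p * q + q ^ 2 - 14 * p - 14 * q + 49 ≤ 0 := by
    rcases lt_or_ge 0 (p ^ 2 + p * q + q ^ 2 - 14 * p - 14 * q + 49) with h | h
    · have : 0 < q / 49 * (p ^ 2 + p * q + q ^ 2 - 14 * p - 14 * q
        + 49) := mul_pos (by positivity) h
      linarith
    · exact h
  exact ⟨(bound_d7 p q hE).1.2, (bound_d7 p q hE).2.2⟩

set_option maxRecDepth 8192 in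
/-- (G3)–(G4) type d7 over ℤ: the positive integer weight pairs with `E_d7 ≤ 0` (the closed ellipse)
form the explicit set `S_d7` of 61 pairs. -/
theorem intPoints_d7 (p q : ℤ) (hp : 1 ≤ p) (hq : 1 ≤ q)
    (hE : p ^ 2 + p * q + q ^ 2 - 14 * p - 14 * q + 49 ≤ 0) :
    (p, q) ∈ ({(1, 4), (1, 5), (1, 6), (1, 7), (1, 8), (1, 9), (2, 3), (2, 4), (2, 5), (2, 6),
        (2, 7), (2, 8), (2, 9), (3, 2), (3, 3), (3, 4), (3, 5), (3, 6), (3, 7), (3, 8), (3, 9),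
        (4, 1), (4, 2), (4, 3), (4, 4), (4, 5), (4, 6), (4, 7), (4, 8), (4, 9), (5, 1), (5, 2),
        (5, 3), (5, 4), (5, 5), (5, 6), (5, 7), (5, 8), (6, 1), (6, 2), (6, 3), (6, 4), (6, 5),
        (6, 6), (6, 7), (7, 1), (7, 2), (7, 3), (7, 4), (7, 5), (7, 6), (7, 7), (8, 1), (8, 2),
        (8, 3), (8, 4), (8, 5), (9, 1), (9, 2), (9, 3), (9, 4)} : Finset (ℤ × ℤ)) := by
  have hp2 : p ≤ 9 := by nlinarith [sq_nonneg (2 * q + p - 14)]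
  have hq2 : q ≤ 9 := by nlinarith [sq_nonneg (2 * p + q - 14)]
  interval_cases p <;> interval_cases q <;> first | decide | (exfalso; norm_num at hE)

set_option maxRecDepth 8192 in
/-- type d7: the LIVE weight pairs of record (memo (G4) = table (41f-2); 55 pairs, weights ≤ 9) form
a subset of `S_d7`. -/
theorem live_sub_d7 :
    ({(1, 5), (1, 6), (1, 7), (1, 8), (2, 3), (2, 4), (2, 5), (2, 6), (2, 7), (2, 8), (2, 9),
        (3, 2), (3, 3), (3, 4), (3, 5), (3, 6), (3, 7), (3, 8), (3, 9), (4, 2), (4, 3), (4, 4),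
        (4, 5), (4, 6), (4, 7), (4, 8), (5, 1), (5, 2), (5, 3), (5, 4), (5, 5), (5, 6), (5, 7),
        (5, 8), (6, 1), (6, 2), (6, 3), (6, 4), (6, 5), (6, 6), (6, 7), (7, 1), (7, 2), (7, 3),
        (7, 4), (7, 5), (7, 6), (7, 7), (8, 1), (8, 2), (8, 3), (8, 4), (8, 5), (9, 2),
        (9, 3)} : Finset (ℤ × ℤ))
      ⊆ ({(1, 4), (1, 5), (1, 6), (1, 7), (1, 8), (1, 9), (2, 3), (2, 4), (2, 5), (2, 6), (2, 7),
          (2, 8), (2, 9), (3, 2), (3, 3), (3, 4), (3, 5), (3, 6), (3, 7), (3, 8), (3, 9), (4, 1),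
          (4, 2), (4, 3), (4, 4), (4, 5), (4, 6), (4, 7), (4, 8), (4, 9), (5, 1), (5, 2), (5, 3),
          (5, 4), (5, 5), (5, 6), (5, 7), (5, 8), (6, 1), (6, 2), (6, 3), (6, 4), (6, 5), (6, 6),
          (6, 7), (7, 1), (7, 2), (7, 3), (7, 4), (7, 5), (7, 6), (7, 7), (8, 1), (8, 2), (8, 3),
          (8, 4), (8, 5), (9, 1), (9, 2), (9, 3), (9, 4)} : Finset (ℤ × ℤ)) := by
  decide

/-! ## Type G: classes G, G2 (N(Δ) = 4); centre a = 5 / 3, box [1 / 3, 3] -/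

/-- (G2) type G: the printed `ñ_a` component of the particular solution equals `-(q / 4) · E_G`. -/
theorem nTildeA_G (p q : K) :
    -(1 / 4) * p ^ 2 * q - (1 / 4) * p * q ^ 2 - (1 / 4) * q ^ 3 + (5 / 4) * p * q
        + (5 / 4) * q ^ 2 - (7 / 4) * q
      = -(q / 4) * (p ^ 2 + p * q + q ^ 2 - 5 * p - 5 * q + 7) := by
  ring

/-- (G2) type G: the printed `ñ_b` component equals `-(p / 4) · E_G`. -/
theorem nTildeB_G (p q : K) :
    -(1 / 4) * p ^ 3 - (1 / 4) * p ^ 2 * q - (1 / 4) * p * q ^ 2 + (5 / 4) * p ^ 2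
        + (5 / 4) * p * q - (7 / 4) * p
      = -(p / 4) * (p ^ 2 + p * q + q ^ 2 - 5 * p - 5 * q + 7) := by
  ring

/-- (G2) type G: centred form `E_G = Q(p - a, q - a) - N(Δ)/3` with a = 5 / 3, N(Δ) = 4. -/
theorem E_centred_G (p q : K) :
    p ^ 2 + p * q + q ^ 2 - 5 * p - 5 * q + 7
      = (p - (5 / 3 : K)) ^ 2 + (p - (5 / 3 : K)) * (q - (5 / 3 : K)) + (q - (5 / 3 : K)) ^ 2
          - (4 / 3 : K) := by
  ring

/-- (G2) type G, unscaled: if `p q n_a = ñ_a` and `p q n_b = ñ_b` with `p, q ≠ 0` then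
`p · n_a = q · n_b = 1/3 - Q(p - a, q - a) / N(Δ)` (the weighted n-law `w_a n_a = w_b n_b`). -/
theorem weightedN_G (p q na nb : K) (hp : p ≠ 0) (hq : q ≠ 0)
    (ha : p * q * na = -(1 / 4) * p ^ 2 * q - (1 / 4) * p * q ^ 2 - (1 / 4) * q ^ 3
        + (5 / 4) * p * q + (5 / 4) * q ^ 2 - (7 / 4) * q)
    (hb : p * q * nb = -(1 / 4) * p ^ 3 - (1 / 4) * p ^ 2 * q - (1 / 4) * p * q ^ 2
        + (5 / 4) * p ^ 2 + (5 / 4) * p * q - (7 / 4) * p) :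
    p * na = 1 / 3 - ((p - (5 / 3 : K)) ^ 2 + (p - (5 / 3 : K)) * (q - (5 / 3 : K)) + (q
        - (5 / 3 : K)) ^ 2) / 4 ∧
      q * nb = 1 / 3 - ((p - (5 / 3 : K)) ^ 2 + (p - (5 / 3 : K)) * (q - (5 / 3 : K)) + (q
          - (5 / 3 : K)) ^ 2) / 4 := by
  refine ⟨mul_left_cancel₀ hq ?_, mul_left_cancel₀ hp ?_⟩
  · rw [← mul_assoc, mul_comm q p, ha]; ring
  · rw [← mul_assoc, hb]; ring

/-- (G3) type G: `4 E_G = (2q + p - 3a)² + 3 (p - lo)(p - hi)` with lo = 1 / 3, hi = 3. -/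
theorem fourE_G (p q : K) :
    4 * (p ^ 2 + p * q + q ^ 2 - 5 * p - 5 * q + 7)
      = (2 * q + p - 5) ^ 2 + 3 * ((p - (1 / 3 : K)) * (p - (3 : K))) := by
  ring

/-- (G3) type G: `E_G ≤ 0` confines both weights to `[lo, hi] = [1 / 3, 3]`. -/
theorem bound_G (p q : F)
    (hE : p ^ 2 + p * q + q ^ 2 - 5 * p - 5 * q + 7 ≤ 0) :
    ((1 / 3 : F) ≤ p ∧ p ≤ 3) ∧ ((1 / 3 : F) ≤ q ∧ q ≤ 3) := by
  refine ⟨⟨?_, ?_⟩, ⟨?_, ?_⟩⟩ <;> nlinarith [fourE_G p q, fourE_G q p,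
    sq_nonneg (2 * q + p - 5), sq_nonneg (2 * p + q - 5)]

/-- (G3) type G: a feasible point of the live system (weight `q > 0`) has `ñ_a ≥ 0`, hence lies in
the box `p, q ≤ 3` (LIVE ⇒ `W ∈ [1..3]²` for positive integer weights). -/
theorem liveBox_G (p q : F) (hq : 0 < q)
    (hna : 0 ≤ -(1 / 4) * p ^ 2 * q - (1 / 4) * p * q ^ 2 - (1 / 4) * q ^ 3 + (5 / 4) * p * q
        + (5 / 4) * q ^ 2 - (7 / 4) * q) :
    p ≤ 3 ∧ q ≤ 3 := by
  rw [nTildeA_G] at hna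
  have hE : p ^ 2 + p * q + q ^ 2 - 5 * p - 5 * q + 7 ≤ 0 := by
    rcases lt_or_ge 0 (p ^ 2 + p * q + q ^ 2 - 5 * p - 5 * q + 7) with h | h
    · have : 0 < q / 4 * (p ^ 2 + p * q + q ^ 2 - 5 * p - 5 * q + 7) := mul_pos (by positivity) h
      linarith
    · exact h
  exact ⟨(bound_G p q hE).1.2, (bound_G p q hE).2.2⟩

/-- (G3)–(G4) type G over ℤ: the positive integer weight pairs with `E_G ≤ 0` (the closed ellipse)
form the explicit set `S_G` of 6 pairs. -/
theorem intPoints_G (p q : ℤ) (hp : 1 ≤ p) (hq : 1 ≤ q)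
    (hE : p ^ 2 + p * q + q ^ 2 - 5 * p - 5 * q + 7 ≤ 0) :
    (p, q) ∈ ({(1, 1), (1, 2), (1, 3), (2, 1), (2, 2), (3, 1)} : Finset (ℤ × ℤ)) := by
  have hp2 : p ≤ 3 := by nlinarith [sq_nonneg (2 * q + p - 5)]
  have hq2 : q ≤ 3 := by nlinarith [sq_nonneg (2 * p + q - 5)]
  interval_cases p <;> interval_cases q <;> first | decide | (exfalso; norm_num at hE)

/-- type G: the LIVE weight pairs of record (memo (G4) = table (41f-2); 3 pairs) form a subset of
`S_G`. -/
theorem live_sub_G :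
    ({(1, 2), (2, 1), (2, 2)} : Finset (ℤ × ℤ))
      ⊆ ({(1, 1), (1, 2), (1, 3), (2, 1), (2, 2), (3, 1)} : Finset (ℤ × ℤ)) := by
  decide

end Summit.Ventures.HSemireg.GenericLiveBound
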